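import Literature.Algebra.Lie.LefschetzModuleAdjoint
import Literature.Algebra.Lie.Sl2ModuleWeights
import HarnessLib

/-!
# Representations of a Lefschetz triple are Lefschetz modules; `𝔤(𝔞, M)` is the image of `𝔤` (Looijenga–Lunts 1997, §1)

Topic `Literature/Algebra/Lie` (namespace `Literature.Algebra.Lie`).  Lane `lit-hodgefound` (Track 2 foundations
library), skeleton seat `lit-hodgefound-skel-1` (generation 41), row **A1-106** of
`run/shared/lean/pub/lit-hodgefound/SKELETON.md`: the sentence of Looijenga–Lunts p. 7 by which "the classification of
Lefschetz modules" reduces "to classifying triples `(𝔤, h, 𝔞)`" — every (non-zero) finite-dimensional representation of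
a Lefschetz triple is a Lefschetz module, with `𝔤(𝔞, M)` the image of `𝔤`.  It generalises A1-101 §3 (the adjoint
representation, `IsLefschetzTriple.isLefschetzModule_ad`) to an arbitrary representation, using A1-101 §1 ("if `h` and
`e` happen to be contained in a semisimple Lie subalgebra … then so is `f`") and the tree's Bourbaki VIII §1 Cor. (i)
(`Sl2ModuleWeights.lean`: the eigenvalues of `ρ(h)` are integers and `ρ(h)` is diagonalisable).  PROVED theorems only
(no definition, no named fact, no `sorry`; D-0026 net debt `0`).  `LieRing.ofAssociativeRing` is enabled FILE-LOCALLY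
as in the rest of the series.

## Source, VERBATIM

E. Looijenga, V. A. Lunts, *A Lie algebra attached to a projective variety*, Invent. Math. **129** (1997) 361–412 (held
text `paper:arxiv-alg-geom_9604014`, p0007 L67–L76; numbered rendering `paper:arxiv-alg-geom-9604014` p0013 L8):

> "If `M` is a finite dimensional representation of `𝔤`, then `h` determines a grading of `M` and every `e ∈ 𝔞` in the
> domain of `f` has the Lefschetz property in `M` with respect to this grading. So `M` is then a Lefschetz module of
> `𝔞`. Since `𝔤` is generated by `𝔞` and the image of `f`, it follows that `𝔤(𝔞, M)` is just the image of `𝔤` in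
> `𝔤𝔩(M)`. This reduces the classification of Lefschetz modules to classifying triples `(𝔤, h, 𝔞)` as above."

(`(𝔤, h, 𝔞)` a Lefschetz triple: `𝔤` semisimple, `h` simple, `𝔞 ⊆ 𝔤₂` abelian with (i), (ii) — A1-84
`IsLefschetzTriple`.)

## Rendering (dictionary, continuing A1-84 / A1-88 / A1-101)

* "a finite dimensional representation of `𝔤`" = a Mathlib Lie module `M` (`LieRingModule L M`, `LieModule K L M`,
  `FiniteDimensional K M`) with `ρ = LieModule.toEnd K L M : 𝔤 →ₗ⁅K⁆ 𝔤𝔩(M)`; "the image of `𝔤` in `𝔤𝔩(M)`" = `ρ.range`;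
  the Lefschetz module is `(ρ 𝔞, M)` = `IsLefschetzModule K (ρ h) (𝔞.map ρ)` (A1-88 renders `(𝔞, M)` on the image of
  `e : 𝔞 → 𝔤𝔩(M)`), which requires `ρ h ≠ 0` (Mathlib's `IsSl2Triple` convention) — equivalently `ρ ≠ 0`
  (`toEnd_eq_zero_of_toEnd_h_eq_zero`); the zero representation, a Lefschetz module in the degenerate printed sense
  (`M = M₀`, `𝔤(𝔞, M) = 0`), is excluded.

## Contents (all proved)

* `isZGrading_toEnd_of_isSl2Triple` ("`h` determines a grading of `M`" — Bourbaki VIII §1 Cor. (i), the tree's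
  `IsSl2Triple.iSup_eigenspace_toEnd_h_intCast_eq_top` BY NAME); `hasLefschetzProperty_toEnd_of_isSl2Triple`,
  `hasLefschetzProperty_toEnd_of_mem_lefschetzDomain` ("every `e ∈ 𝔞` in the domain of `f` has the Lefschetz property in
  `M`"); `IsLefschetzTriple.toEnd_eq_zero_of_toEnd_h_eq_zero` (`ρ h = 0 ⟹ ρ = 0`);
  **`IsLefschetzTriple.lefschetzLieAlgebra_map_toEnd`** ("`𝔤(𝔞, M)` is just the image of `𝔤` in `𝔤𝔩(M)`":
  `𝔤(ρ 𝔞, M) = ρ(𝔤)`); **`IsLefschetzTriple.isLefschetzModule_toEnd`** ("So `M` is then a Lefschetz module of `𝔞`").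
* The case `𝔤 ⊆ 𝔤𝔩(M)` (`ρ` = the inclusion; private plumbing `toEnd_lieSubalgebra_apply`,
  `range_toEnd_lieSubalgebra`, `map_toEnd_inSubalgebra`, `toEnd_lieSubalgebra_ne_zero`):
  **`IsLefschetzTriple.lefschetzLieAlgebra_eq_of_lieSubalgebra`**
  (`𝔤(𝔞, M) = 𝔤`), **`IsLefschetzTriple.isLefschetzModule_of_lieSubalgebra`**, and the round trip
  **`isLefschetzModule_iff_isLefschetzTriple`** ("this reduces the classification of Lefschetz modules to classifying
  triples": `(𝔞, M)` is a Lefschetz module iff `(𝔤(𝔞, M), h, 𝔞)` is a Lefschetz triple — with A1-101 §2).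

## Proof (the source gives none beyond the quoted sentences)

The grading: Bourbaki VIII §1 Cor. (i) of Prop. 2 (p36's file, complete reducibility + primitive vectors).  The
Lefschetz property: (1.1) for the `𝔰𝔩₂`-triple `(ρ e, ρ h, ρ f_e)` of `𝔤𝔩(M)`.  `𝔤(ρ 𝔞, M) ⊇ ρ(𝔤)`:
`ρ(𝔤) = ρ(lieSpan(𝔞 ∪ f(dom f))) = lieSpan(ρ 𝔞 ∪ ρ f(dom f))` (A1-101 `map_lieSpan`) and each `ρ f_e` is the partner of
`ρ e`.  `𝔤(ρ 𝔞, M) ⊆ ρ(𝔤)`: `ρ(𝔤)` is a semisimple Lie subalgebra of `𝔤𝔩(M)` containing `ρ h` and the `ρ e_a`, so it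
contains every partner of every Lefschetz `ρ e_a` (A1-101 `mem_of_isSl2Triple` — Morozov's lemma; `ρ` need not be
injective).  Semisimplicity of `𝔤(ρ 𝔞, M) = ρ(𝔤)`: surjective image of the semisimple `𝔤`.

## SCOPE (what is NOT formalised here)

(a) The zero representation (see Rendering).  (b) "Lefschetz pair", "saturated" (p. 7 L77–L84) are not defined here.
(c) Nothing here concerns complex tori or the Hodge conjecture.

## References

* [LooijengaLunts1997] E. Looijenga, V. A. Lunts, *A Lie algebra attached to a projective variety*, Invent. Math. 129
  (1997) 361–412; arXiv:alg-geom/9604014. §1 p. 7 L67–L76 (held `paper:arxiv-alg-geom_9604014`); (1.1) p. 4 L25–L26.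
* [Bourbaki2008LieGroups79] N. Bourbaki, *Lie Groups and Lie Algebras, Chapters 7–9*, Ch. VIII §1 no. 2 Cor. (i) of
  Prop. 2 (held p0092) — via the tree's `Sl2ModuleWeights.lean`.
-/

noncomputable section

namespace Literature.Algebra.Lie

open Module Function Set LieModule LieAlgebra

-- The commutator Lie ring of `𝔤𝔩(M) = Module.End K M`: Mathlib's reducible NON-instance, enabled file-locally
-- exactly as in `LefschetzModule.lean`.
attribute [local instance 100] LieRing.ofAssociativeRing

section Representation

variable {K : Type*} [Field K] [CharZero K] {L : Type*} [LieRing L] [LieAlgebra K L]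
  {M : Type*} [AddCommGroup M] [Module K M] [FiniteDimensional K M] [LieRingModule L M] [LieModule K L M]
  {h : L} {𝔞 : Submodule K L}

/-- **"If `M` is a finite dimensional representation of `𝔤`, then `h` determines a grading of `M`"**: for a simple
element `h` (middle of an `𝔰𝔩₂`-triple), `ρ(h)` is diagonalisable on `M` with integer eigenvalues — `(M, ρ h)` is
`ℤ`-graded in the sense of A1-88 (Bourbaki VIII §1 no. 2 Cor. (i) of Prop. 2, the tree's
`IsSl2Triple.iSup_eigenspace_toEnd_h_intCast_eq_top`, BY NAME). [cite: LooijengaLunts1997, §1 p. 7 L67–L68]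
[cite: Bourbaki2008LieGroups79, Ch. VIII §1 no. 2 Cor. (i) of Prop. 2 (p0092)] -/
theorem isZGrading_toEnd_of_isSl2Triple {e f : L} (t : IsSl2Triple h e f) : IsZGrading (toEnd K L M h) :=
  IsSl2Triple.iSup_eigenspace_toEnd_h_intCast_eq_top (M := M) t

/-- **"… and every `e ∈ 𝔞` in the domain of `f` has the Lefschetz property in `M` with respect to this grading"**:
`(ρ e)^k : M_{-k} ≅ M_k` — (1.1) for the `𝔰𝔩₂`-triple `(ρ e, ρ h, ρ f_e)` of `𝔤𝔩(M)` (when `ρ h ≠ 0`, i.e. `ρ ≠ 0`).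
[cite: LooijengaLunts1997, §1 p. 7 L68–L70] -/
theorem hasLefschetzProperty_toEnd_of_isSl2Triple {e f : L} (t : IsSl2Triple h e f) (h0 : toEnd K L M h ≠ 0) :
    HasLefschetzProperty (toEnd K L M h) (toEnd K L M e) :=
  hasLefschetzProperty_of_isSl2Triple (isZGrading_toEnd_of_isSl2Triple t) (isSl2Triple_map_of_ne_zero (toEnd K L M) t h0)

omit [FiniteDimensional K M] in
/-- For a Lefschetz triple `(𝔤, h, 𝔞)`, a representation `ρ` with `ρ(h) = 0` is zero: `ρ e_a = ½[ρ h, ρ e_a] = 0` and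
`ρ f = -½[ρ h, ρ f] = 0` on the generators. So "`ρ h ≠ 0`" below just says `ρ ≠ 0`.
[cite: LooijengaLunts1997, §1 p. 7 L66–L71] -/
theorem IsLefschetzTriple.toEnd_eq_zero_of_toEnd_h_eq_zero (T : IsLefschetzTriple K h 𝔞) (h0 : toEnd K L M h = 0) :
    toEnd K L M = 0 := by
  have hgen : ∀ x ∈ ((𝔞 : Set L) ∪ lefschetzDuals K h 𝔞), toEnd K L M x = 0 := by
    rintro x (hx | ⟨e, he, t⟩)
    · have h1 := mem_adDegree_iff.1 (T.le_adDegree_two hx)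
      have h2 : (2 : K) • toEnd K L M x = 0 := by rw [← map_smul, ← h1, LieHom.map_lie, h0, zero_lie]
      exact (smul_eq_zero.1 h2).resolve_left two_ne_zero
    · have h2 : (2 : K) • toEnd K L M x = 0 := by
        have h3 := congrArg (toEnd K L M) (t.lie_lie_smul_f K)
        rw [LieHom.map_lie, h0, zero_lie, map_neg, map_smul] at h3
        exact neg_eq_zero.1 h3.symm
      exact (smul_eq_zero.1 h2).resolve_left two_ne_zero
  have hle : (⊤ : LieSubalgebra K L) ≤ (toEnd K L M).ker := by
    rw [← T.lieSpan_eq_top, LieSubalgebra.lieSpan_le]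
    intro x hx
    exact LieHom.mem_ker.2 (hgen x hx)
  ext x m
  have h1 : x ∈ (toEnd K L M).ker := hle (LieSubalgebra.mem_top x)
  rw [LieHom.mem_ker] at h1
  rw [h1, LieHom.zero_apply]

/-- Every Lefschetz `e ∈ 𝔞` (an `e` in the domain of `f`) acts on such an `M` with the Lefschetz property.
[cite: LooijengaLunts1997, §1 p. 7 L68–L70] -/
theorem hasLefschetzProperty_toEnd_of_mem_lefschetzDomain (h0 : toEnd K L M h ≠ 0) {e : L}
    (he : e ∈ lefschetzDomain K h 𝔞) : HasLefschetzProperty (toEnd K L M h) (toEnd K L M e) := by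
  obtain ⟨f, t⟩ := he.2
  exact hasLefschetzProperty_toEnd_of_isSl2Triple t h0

variable [FiniteDimensional K L]

/-- **"Since `𝔤` is generated by `𝔞` and the image of `f`, it follows that `𝔤(𝔞, M)` is just the image of `𝔤` in
`𝔤𝔩(M)`"** — for a Lefschetz triple `(𝔤, h, 𝔞)` and a representation `ρ` with `ρ h ≠ 0`:
`𝔤(ρ 𝔞, M) = ρ(𝔤)`.  `⊇`: `ρ(𝔤) = ρ(lieSpan(𝔞 ∪ f(dom f))) = lieSpan(ρ 𝔞 ∪ ρ f(dom f))` (A1-101 `map_lieSpan`) and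
`ρ f_e` is the partner of `ρ e`.  `⊆`: every partner in `𝔤𝔩(M)` of a Lefschetz `ρ e_a` lies in the semisimple `ρ(𝔤)`
("if `h` and `e` happen to be contained in a semisimple Lie subalgebra … then so is `f`", A1-101
`mem_of_isSl2Triple`). [cite: LooijengaLunts1997, §1 p. 7 L70–L72, (1.1) p. 4 L25–L26] -/
theorem IsLefschetzTriple.lefschetzLieAlgebra_map_toEnd (T : IsLefschetzTriple K h 𝔞) (h0 : toEnd K L M h ≠ 0) :
    lefschetzLieAlgebra K (toEnd K L M h) (𝔞.map (toEnd K L M : L →ₗ[K] Module.End K M)) = (toEnd K L M).range := by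
  haveI := T.isSemisimple
  haveI : FiniteDimensional K (toEnd K L M).range :=
    inferInstanceAs (FiniteDimensional K (toEnd K L M).range.toSubmodule)
  haveI : LieAlgebra.IsSemisimple K (toEnd K L M).range :=
    isSemisimple_of_surjective (toEnd K L M).rangeRestrict (LieHom.surjective_rangeRestrict _)
  refine le_antisymm ?_ ?_
  · rw [lefschetzLieAlgebra_le_iff]
    refine ⟨?_, ?_⟩
    · rintro _ ⟨a, -, rfl⟩
      exact LieHom.mem_range_self _ a
    · rintro F ⟨E, hE, t⟩
      obtain ⟨a, -, rfl⟩ := Submodule.mem_map.1 hE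
      exact mem_of_isSl2Triple _ (LieHom.mem_range_self _ h) (LieHom.mem_range_self _ a) t
  · rw [LieHom.range_eq_map, ← T.lefschetzLieAlgebra_eq_top, lefschetzLieAlgebra, map_lieSpan, lefschetzLieAlgebra,
      LieSubalgebra.lieSpan_le, Set.image_union]
    rintro F (⟨a, ha, rfl⟩ | ⟨f, ⟨e, he, t⟩, rfl⟩)
    · exact mem_lefschetzLieAlgebra_of_mem (Submodule.mem_map_of_mem ha)
    · exact mem_lefschetzLieAlgebra_of_isSl2Triple (Submodule.mem_map_of_mem he)
        (isSl2Triple_map_of_ne_zero (toEnd K L M) t h0)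

/-- **"So `M` is then a Lefschetz module of `𝔞`"**: a finite-dimensional representation `ρ ≠ 0` of a Lefschetz triple
`(𝔤, h, 𝔞)` (`𝔤` finite-dimensional, characteristic `0`) makes `(ρ 𝔞, M)` a Lefschetz module in the sense of A1-88 —
`(M, ρ h)` is `ℤ`-graded, `ρ 𝔞 ⊆ 𝔤𝔩(M)₂` is abelian, `ρ e` (for `e ∈ dom f`) has the partner `ρ f_e`, and
`𝔤(ρ 𝔞, M) = ρ(𝔤)` is semisimple.  (The case `M = 𝔤`, `ρ = ad` is A1-101's `isLefschetzModule_ad`.)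
[cite: LooijengaLunts1997, §1 p. 7 L67–L72] -/
theorem IsLefschetzTriple.isLefschetzModule_toEnd (T : IsLefschetzTriple K h 𝔞) (h0 : toEnd K L M h ≠ 0) :
    IsLefschetzModule K (toEnd K L M h) (𝔞.map (toEnd K L M : L →ₗ[K] Module.End K M)) where
  isZGrading := by
    obtain ⟨e, f, t⟩ := T.isSimpleElement
    exact isZGrading_toEnd_of_isSl2Triple t
  le_adDegree_two := by
    rintro _ ⟨a, ha, rfl⟩
    rw [mem_adDegree_iff]
    show ⁅toEnd K L M h, toEnd K L M a⁆ = (2 : K) • toEnd K L M a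
    rw [← LieHom.map_lie, mem_adDegree_iff.1 (T.le_adDegree_two ha), map_smul]
  lie_eq_zero := by
    rintro _ ⟨a, ha, rfl⟩ _ ⟨b, hb, rfl⟩
    show ⁅toEnd K L M a, toEnd K L M b⁆ = 0
    rw [← LieHom.map_lie, T.lie_eq_zero a ha b hb, map_zero]
  nonempty_lefschetzDomain := by
    obtain ⟨e, he, f, t⟩ := T.nonempty_lefschetzDomain
    exact ⟨toEnd K L M e, Submodule.mem_map_of_mem he, toEnd K L M f, isSl2Triple_map_of_ne_zero (toEnd K L M) t h0⟩
  isSemisimple := by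
    haveI := T.isSemisimple
    haveI : FiniteDimensional K (toEnd K L M).range :=
      inferInstanceAs (FiniteDimensional K (toEnd K L M).range.toSubmodule)
    rw [T.lefschetzLieAlgebra_map_toEnd h0]
    exact isSemisimple_of_surjective (toEnd K L M).rangeRestrict (LieHom.surjective_rangeRestrict _)

end Representation

/-! ## "𝔤(𝔞, M) is just the image of 𝔤 in 𝔤𝔩(M)" for `𝔤 ⊆ 𝔤𝔩(M)`, and "this reduces the classification of
Lefschetz modules to classifying triples" -/

section InsideGl

variable {K : Type*} [Field K] [CharZero K]
  {M : Type*} [AddCommGroup M] [Module K M] [FiniteDimensional K M]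
  {h : Module.End K M} {𝔞 : Submodule K (Module.End K M)}

omit [CharZero K] [FiniteDimensional K M] in
/-- The representation of a Lie subalgebra `𝔤 ⊆ 𝔤𝔩(M)` on `M` is the inclusion `𝔤 ↪ 𝔤𝔩(M)`. [folklore] -/
private theorem toEnd_lieSubalgebra_apply (G : LieSubalgebra K (Module.End K M)) (x : G) :
    toEnd K G M x = (x : Module.End K M) :=
  LinearMap.ext fun _ => rfl

omit [CharZero K] [FiniteDimensional K M] in
/-- … so "the image of `𝔤` in `𝔤𝔩(M)`" is `𝔤`. [folklore] -/
private theorem range_toEnd_lieSubalgebra (G : LieSubalgebra K (Module.End K M)) : (toEnd K G M).range = G := by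
  ext x
  rw [LieHom.mem_range]
  constructor
  · rintro ⟨y, rfl⟩
    rw [toEnd_lieSubalgebra_apply]
    exact y.2
  · intro hx
    exact ⟨⟨x, hx⟩, toEnd_lieSubalgebra_apply G ⟨x, hx⟩⟩

omit [CharZero K] [FiniteDimensional K M] in
/-- … and the image of `𝔞 ⊆ 𝔤` (the copy `inSubalgebra 𝔤 𝔞` of A1-101) is `𝔞`. [folklore] -/
private theorem map_toEnd_inSubalgebra (G : LieSubalgebra K (Module.End K M)) (hG𝔞 : 𝔞 ≤ G.toSubmodule) :
    (inSubalgebra G 𝔞).map (toEnd K G M : G →ₗ[K] Module.End K M) = 𝔞 := by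
  ext x
  rw [Submodule.mem_map]
  constructor
  · rintro ⟨y, hy, rfl⟩
    rw [LieHom.coe_toLinearMap, toEnd_lieSubalgebra_apply]
    exact mem_inSubalgebra_iff.1 hy
  · intro hx
    exact ⟨⟨x, hG𝔞 hx⟩, mem_inSubalgebra_iff.2 hx, toEnd_lieSubalgebra_apply G ⟨x, hG𝔞 hx⟩⟩

omit [CharZero K] [FiniteDimensional K M] in
/-- A middle element `h ∈ 𝔤 ⊆ 𝔤𝔩(M)` of an `𝔰𝔩₂`-triple of `𝔤` acts non-trivially on `M`. [folklore] -/
private theorem toEnd_lieSubalgebra_ne_zero (G : LieSubalgebra K (Module.End K M)) {hh : h ∈ G}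
    {e f : G} (t : IsSl2Triple (⟨h, hh⟩ : G) e f) : toEnd K G M ⟨h, hh⟩ ≠ 0 := by
  rw [toEnd_lieSubalgebra_apply]
  intro h0
  exact t.h_ne_zero (Subtype.ext h0)

/-- **"It follows that `𝔤(𝔞, M)` is just the image of `𝔤` in `𝔤𝔩(M)`"**, for a Lefschetz triple `(𝔤, h, 𝔞)` with
`𝔤` a Lie subalgebra of `𝔤𝔩(M)` (`M` finite-dimensional, characteristic `0`): `𝔤(𝔞, M) = 𝔤`.
[cite: LooijengaLunts1997, §1 p. 7 L71–L75] -/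
theorem IsLefschetzTriple.lefschetzLieAlgebra_eq_of_lieSubalgebra (G : LieSubalgebra K (Module.End K M)) {hh : h ∈ G}
    (hG𝔞 : 𝔞 ≤ G.toSubmodule) (T : IsLefschetzTriple K (⟨h, hh⟩ : G) (inSubalgebra G 𝔞)) :
    lefschetzLieAlgebra K h 𝔞 = G := by
  haveI : FiniteDimensional K G := inferInstanceAs (FiniteDimensional K G.toSubmodule)
  obtain ⟨e, f, t⟩ := T.isSimpleElement
  have h1 := T.lefschetzLieAlgebra_map_toEnd (M := M) (toEnd_lieSubalgebra_ne_zero G t)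
  rwa [map_toEnd_inSubalgebra G hG𝔞, toEnd_lieSubalgebra_apply, range_toEnd_lieSubalgebra] at h1

/-- **"So `M` is then a Lefschetz module of `𝔞`"**, for a Lefschetz triple `(𝔤, h, 𝔞)` inside `𝔤𝔩(M)`: `(𝔞, M)` is a
Lefschetz module (A1-88 `IsLefschetzModule`) — the converse of A1-101's `IsLefschetzModule.isLefschetzTriple`.
[cite: LooijengaLunts1997, §1 p. 7 L67–L71] -/
theorem IsLefschetzTriple.isLefschetzModule_of_lieSubalgebra (G : LieSubalgebra K (Module.End K M)) {hh : h ∈ G}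
    (hG𝔞 : 𝔞 ≤ G.toSubmodule) (T : IsLefschetzTriple K (⟨h, hh⟩ : G) (inSubalgebra G 𝔞)) :
    IsLefschetzModule K h 𝔞 := by
  haveI : FiniteDimensional K G := inferInstanceAs (FiniteDimensional K G.toSubmodule)
  obtain ⟨e, f, t⟩ := T.isSimpleElement
  have h1 := T.isLefschetzModule_toEnd (M := M) (toEnd_lieSubalgebra_ne_zero G t)
  rwa [map_toEnd_inSubalgebra G hG𝔞, toEnd_lieSubalgebra_apply] at h1

/-- **"This reduces the classification of Lefschetz modules to classifying triples `(𝔤, h, 𝔞)`"**: `(𝔞, M)` is a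
Lefschetz module (A1-88) if and only if `h ∈ 𝔤(𝔞, M)` and `(𝔤(𝔞, M), h, 𝔞)` is a Lefschetz triple (A1-84) — the
forward direction is A1-101's `IsLefschetzModule.isLefschetzTriple`, the backward one the paragraph formalised here.
[cite: LooijengaLunts1997, §1 p. 7 L67–L77] -/
theorem isLefschetzModule_iff_isLefschetzTriple :
    IsLefschetzModule K h 𝔞 ↔ ∃ hh : h ∈ lefschetzLieAlgebra K h 𝔞,
      IsLefschetzTriple K (⟨h, hh⟩ : lefschetzLieAlgebra K h 𝔞) (inSubalgebra (lefschetzLieAlgebra K h 𝔞) 𝔞) :=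
  ⟨fun A => ⟨A.h_mem, A.isLefschetzTriple⟩,
    fun ⟨_, T⟩ => T.isLefschetzModule_of_lieSubalgebra _ le_lefschetzLieAlgebra⟩

end InsideGl

end Literature.Algebra.Lie
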